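import Literature.MathematicalPhysics.QuantumFieldTheory.YangMillsOS
import Literature.MathematicalPhysics.QuantumFieldTheory.OSDataSpeciesExtension
import HarnessLib

/-!
# The Yang–Mills existential from ONE species: zero renormalisation of every other observable

`IsYangMillsFor r sch T` (file `YangMillsOS.lean`) ties the joint Schwinger functions of EVERY
string of gauge-invariant local lattice observables (`YMSpecies G`) to their continuum limits along
the sequential scheme `sch`, whose per-species multiplicative renormalisations `c_s(k)` are witness
data (Jaffe–Witten §4 fn. 1). The module docstring of `YangMillsOS.lean` records the design
consequence: "a degenerate witness could present few non-zero species. `HasLatticeMassGap` closes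
this" — the full-spectrum content is carried by the all-observable lattice clause, not by the
continuum species. This file makes the bookkeeping precise:

* `latticeSchwinger_eq_zero_of_c_eq_zero` — a species string containing a label with `c_s(k) = 0`
  has vanishing joint lattice `n`-point function at step `k` (one smeared factor is `0`);
* `isYangMillsFor_of_oneSpecies` — if every species other than the curvature `r.curvature` has
  `c_s ≡ 0`, then OS data `T` that extend (by zero, `OSDataSpeciesExtension.lean`) the limit of
  the curvature strings satisfy `IsYangMillsFor r sch T`;
* `exists_yangMillsWitness_of_oneSpecies` — consequently the conclusion of the `YangMills`
  statement for `(G, r, sch)` follows from: one-field OS data `T₀ : OSData Unit 4` that are the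
  off-diagonal limit of the renormalised curvature `n`-point functions, `T₀` non-trivial,
  non-Gaussian, with mass gap `Δ > 0`, and `HasLatticeMassGap r sch Δ` (all pairs of lattice
  observables at the scheme's couplings).

So every existence proof may construct the continuum limit of `tr F²` ALONE (plus the lattice gap
for all observables); the other `2^ℵ₀` species cost nothing. Pure bookkeeping over the interface;
no facts, no definitions.

## References

* A. Jaffe, E. Witten, *Quantum Yang–Mills theory* (Clay 2000), §4 (fn. 1), §6.
* K. Osterwalder, R. Schrader, CMP 31 (1973), §6 (several fields).
-/

open scoped SchwartzMap
open MeasureTheory Filter Topology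
open Literature.MathematicalPhysics.AQFT Literature.MathematicalPhysics.QuantumLattice
open Literature.Probability.LatticeModels

noncomputable section

namespace Literature.MathematicalPhysics.QuantumFieldTheory

section Zeroing

variable {G : Type} [Group G] [MeasurableSpace G] [TopologicalSpace G] [IsTopologicalGroup G]
  [CompactSpace G] [BorelSpace G] {N : ℕ} {ι : Type}

/-- **A zero-renormalised factor kills the joint lattice `n`-point function**: if the species
`σ i` of the string has multiplicative renormalisation `c_{σ i}(k) = 0`, the smeared field
`Φ^{σ i}_{a_k}(f_i) = c a⁴ ∑ … ` vanishes identically, hence so does the product and its integral.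
[folklore] -/
theorem latticeSchwinger_eq_zero_of_c_eq_zero (ρ : G →* Matrix (Fin N) (Fin N) ℂ)
    (sch : SpeciesScheme ι) (obs : ι → LGConfig 4 G → ℝ) (k n : ℕ) (σ : Fin n → ι)
    (f : Fin n → 𝓢(EuclideanSpace ℝ (Fin 4), ℝ)) {i : Fin n} (hi : sch.c (σ i) k = 0) :
    latticeSchwinger ρ sch obs k n σ f = 0 := by
  unfold latticeSchwinger
  have h0 : ∀ U : LGConfig 4 G,
      (∏ j, smearedLatticeField (obs (σ j)) (box 4 (sch.L k)) (sch.a k) (sch.c (σ j) k)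
        (sch.m (σ j) k) (f j) U) = 0 := fun U =>
    Finset.prod_eq_zero (Finset.mem_univ i) (by simp [smearedLatticeField, hi])
  simp [h0]

end Zeroing

section OneSpecies

variable {G : Type} [Group G] [MeasurableSpace G] [TopologicalSpace G] [IsTopologicalGroup G]
  [CompactSpace G] [BorelSpace G]

/-- **`IsYangMillsFor` from the curvature strings alone.** Let the scheme renormalise every
species other than `r.curvature` to zero (`c_s ≡ 0`), and let `T` be OS data over `YMSpecies G`
reading `T₀` (labels pulled back along `φ`) on all-curvature strings and `0` on every other
string. If the joint lattice `n`-point functions of the curvature strings converge off-diagonally to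
`T₀`, then `IsYangMillsFor r sch T`: on a string touching another species both sides vanish.
[cite: JaffeWitten2000, §4 fn. 1 and §6] -/
theorem isYangMillsFor_of_oneSpecies {κ : Type} (r : LatticeRep G)
    (sch : SpeciesScheme (YMSpecies G))
    (T₀ : OSData κ 4) (φ : YMSpecies G → κ) {T : OSData (YMSpecies G) 4}
    (hlive : ∀ (n : ℕ) (k : Fin n → YMSpecies G), (∀ i, k i = r.curvature) →
      T.schwinger n k = T₀.schwinger n (φ ∘ k))
    (hdead : ∀ (n : ℕ) (k : Fin n → YMSpecies G), (¬ ∀ i, k i = r.curvature) → T.schwinger n k = 0)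
    (hc : ∀ s : YMSpecies G, s ≠ r.curvature → ∀ k, sch.c s k = 0)
    (hconv : ∀ n : ℕ, n ≠ 0 → ∀ (f : Fin n → 𝓢(EuclideanSpace ℝ (Fin 4), ℝ))
      (F : 𝓢((Fin n → EuclideanSpace ℝ (Fin 4)), ℂ)),
      IsTensorOf F (fun i => ofRealTest (f i)) → IsOffDiagonal F →
        Tendsto (fun k : ℕ => ((latticeSchwinger r.ρ sch (fun s => s.F) k n (fun _ => r.curvature) f
          : ℝ) : ℂ)) atTop (𝓝 (T₀.schwinger n (fun _ => φ r.curvature) F))) :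
    IsYangMillsFor r sch T := by
  intro n hn σ f F hF hoff
  by_cases hσ : ∀ i, σ i = r.curvature
  · have hσ' : σ = fun _ => r.curvature := funext hσ
    subst hσ'
    rw [hlive n _ hσ]
    exact hconv n hn f F hF hoff
  · rw [hdead n σ hσ]
    obtain ⟨i, hi⟩ := not_forall.mp hσ
    have h0 : ∀ k, latticeSchwinger r.ρ sch (fun s => s.F) k n σ f = 0 := fun k =>
      latticeSchwinger_eq_zero_of_c_eq_zero r.ρ sch _ k n σ f (hc _ hi k)
    simp only [h0, zero_apply, Complex.ofReal_zero]
    exact tendsto_const_nhds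

/-- **The Yang–Mills existential for `(G, r, sch)` from ONE species.** Suppose the scheme
renormalises every species other than the curvature to zero, and one-field OS data
`T₀ : OSData Unit 4` are the off-diagonal limit of the renormalised joint `n`-point functions of
the curvature `tr F²` along `sch`, with `T₀` non-trivial, non-Gaussian and of mass gap `Δ > 0`;
suppose the all-observable lattice clause `HasLatticeMassGap r sch Δ`. Then there are OS data `T`
over ALL gauge-invariant local observables with `IsYangMillsFor r sch T`, non-trivial and
non-Gaussian curvature, `T.HasMassGap Δ` and `HasLatticeMassGap r sch Δ` — the conclusion of
`YangMills` at `G` (witnessed by `r`, `sch`): `T` is the extension of `T₀` by zero.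
[cite: JaffeWitten2000, §4 and §6] -/
theorem exists_yangMillsWitness_of_oneSpecies (r : LatticeRep G) (sch : SpeciesScheme (YMSpecies G))
    (hc : ∀ s : YMSpecies G, s ≠ r.curvature → ∀ k, sch.c s k = 0)
    (T₀ : OSData Unit 4)
    (hconv : ∀ n : ℕ, n ≠ 0 → ∀ (f : Fin n → 𝓢(EuclideanSpace ℝ (Fin 4), ℝ))
      (F : 𝓢((Fin n → EuclideanSpace ℝ (Fin 4)), ℂ)),
      IsTensorOf F (fun i => ofRealTest (f i)) → IsOffDiagonal F →
        Tendsto (fun k : ℕ => ((latticeSchwinger r.ρ sch (fun s => s.F) k n (fun _ => r.curvature) f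
          : ℝ) : ℂ)) atTop (𝓝 (T₀.schwinger n (fun _ => ()) F)))
    (hNT : T₀.IsNontrivial ()) (hNG : T₀.IsNonGaussian ()) {Δ : ℝ} (hΔ : 0 < Δ)
    (hgap : T₀.HasMassGap Δ) (hlat : HasLatticeMassGap r sch Δ) :
    ∃ T : OSData (YMSpecies G) 4, IsYangMillsFor r sch T ∧ T.IsNontrivial r.curvature ∧
      T.IsNonGaussian r.curvature ∧ ∃ Δ > 0, T.HasMassGap Δ ∧ HasLatticeMassGap r sch Δ := by
  obtain ⟨T, hlive, hdead⟩ :=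
    OSData.exists_extendByZero T₀ (fun _ : YMSpecies G => ()) (fun s => s = r.curvature)
  refine ⟨T, ?_, ?_, ?_, Δ, hΔ, ?_, hlat⟩
  · exact isYangMillsFor_of_oneSpecies r sch T₀ (fun _ => ()) hlive hdead hc hconv
  · exact OSData.isNontrivial_of_extendByZero T₀ (fun _ : YMSpecies G => ())
      (fun s => s = r.curvature) hlive rfl hNT
  · exact OSData.isNonGaussian_of_extendByZero T₀ (fun _ : YMSpecies G => ())
      (fun s => s = r.curvature) hlive rfl hNG
  · exact OSData.hasMassGap_of_extendByZero T₀ (fun _ : YMSpecies G => ())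
      (fun s => s = r.curvature) hlive hdead hgap

end OneSpecies

end Literature.MathematicalPhysics.QuantumFieldTheory

end
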